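import Literature.Probability.Percolation.StripWindowsFine
import Literature.Probability.Percolation.PortCountSqCutoff
import HarnessLib

/-!
# The zones of a strip and their mesh-independent owner count

Topic `Probability/Percolation`.  Support file (definitions and proofs, no named fact) for the zone
geometry of the proof of Schramm–Smirnov's Prop. 4.1 (Ann. Probab. 39 (2011), §4), per-strip form:
the gluing zones `StripData.stripZones` of a maximal strip (window = its fine tube blocks, excised
squares = its excised cores, everything else far) are NICE and satisfy the hypotheses of the tile
construction with squares (`ZonesSqOwners.lean`) and of the cut-off at the squares
(`PortCountSqCutoff.lean`: the outside of the window is connected through non-window sites,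
`stripZones_Wconn`), whence the owner bound `exists_owners_stripZones` with the mesh-independent
square terms.

## References

* O. Schramm, S. Smirnov, Ann. Probab. 39 (2011), arXiv:1101.5820, §4, proof of Prop. 4.1 (the
  strips and the discs; "on ¬S the number of bays is bounded"). [SchrammSmirnov2011]
-/

noncomputable section

open Set Relation
open Literature.Probability.LatticeModels
open scoped Classical

namespace Literature.Probability.Percolation

namespace FineBlocks.StripData

open FineBlocks Seeded CellComplex

variable (𝔖 : StripData) {R : ℤ} (k : Fin 𝔖.n) (hR : 0 < R) (t δ : ℝ) (ht : 0 < t) (hδ : 0 < δ)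

/-- **The gluing zones of a strip** at refinement ratio `R`, fine block side `t` and mesh `δ`.
[cite: SchrammSmirnov2011, §4, proof of Prop. 4.1 (the strip K_j and the discs at its ends)] -/
def stripZones : Zones := (𝔖.blockData k hR).blockZones t δ ht hδ

variable {𝔖 k hR t δ ht hδ} (hR4 : 4 ≤ R) (hδt : 2 * δ ≤ t)

include hR4 hδt in
/-- **The zones of a strip are nice.** [folklore] -/
theorem stripZones_nice : (𝔖.stripZones k hR t δ ht hδ).Nice :=
  (𝔖.blockData k hR).blockZones_nice hδt (blockData_NB_conn hR4) blockData_far_conn blockData_SQ_far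

include hδt in
/-- Every tube site of the strip zones has a non-square neighbour. [folklore] -/
theorem stripZones_N_edge : ∀ n ∈ (𝔖.stripZones k hR t δ ht hδ).N, ∃ j : Fin 4,
    n + cornerUnit j ∉ (𝔖.stripZones k hR t δ ht hδ).SQ :=
  (𝔖.blockData k hR).blockZones_N_edge hδt

include hδt in
/-- The far sites of the strip zones are one component. [folklore] -/
theorem stripZones_far_conn : ∀ u ∈ (𝔖.stripZones k hR t δ ht hδ).Far, ∀ u' ∈ (𝔖.stripZones k hR t δ ht hδ).Far,
    ReflTransGen (fun a b => a ∈ (𝔖.stripZones k hR t δ ht hδ).Far ∧ b ∈ (𝔖.stripZones k hR t δ ht hδ).Far ∧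
      (zdGraph 2).Adj a b) u u' :=
  (𝔖.blockData k hR).blockZones_far_conn hδt blockData_far_conn

include hR4 hδt in
/-- Square corners of faces chain to tube-edge faces. [folklore] -/
theorem stripZones_SQ_esc : ∀ q ∈ (𝔖.stripZones k hR t δ ht hδ).SQ, ∀ f, TouchesFace q f →
    ∃ g, (∃ e ∈ (𝔖.stripZones k hR t δ ht hδ).tubeEdges, IsFaceOf g e) ∧
      ReflTransGen (fun a b => ∃ u, TouchesFace u a ∧ TouchesFace u b ∧ u ∈ (𝔖.stripZones k hR t δ ht hδ).SQ) f g :=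
  (𝔖.blockData k hR).blockZones_SQ_esc hδt (blockData_SQ_inner hR4)

/-- The window of the strip zones is finite. [folklore] -/
theorem stripZones_Wv_finite : (𝔖.stripZones k hR t δ ht hδ).Wv.Finite :=
  ((𝔖.stripZones k hR t δ ht hδ).K ∪ (𝔖.stripZones k hR t δ ht hδ).N).finite_toSet.subset fun v hv => by
    rcases hv with h | h
    · exact Finset.mem_coe.2 (Finset.mem_union_left _ h)
    · exact Finset.mem_coe.2 (Finset.mem_union_right _ h)

include hδt in
/-- **The outside of the window is connected through non-window sites** (excised blocks chain to far
blocks, far blocks are one component, and block chains lift to site chains). [folklore] -/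
theorem stripZones_Wconn : ∀ u u', u ∉ (𝔖.stripZones k hR t δ ht hδ).Wv → u' ∉ (𝔖.stripZones k hR t δ ht hδ).Wv →
    ReflTransGen (fun a b => a ∉ (𝔖.stripZones k hR t δ ht hδ).Wv ∧ b ∉ (𝔖.stripZones k hR t δ ht hδ).Wv ∧
      (zdGraph 2).Adj a b) u u' := by
  set B := 𝔖.blockData k hR with hB
  -- block chains outside `TT`
  set P : ℤ × ℤ → ℤ × ℤ → Prop := fun x y => x ∈ (↑B.TT : Set (ℤ × ℤ))ᶜ ∧ y ∈ (↑B.TT : Set (ℤ × ℤ))ᶜ ∧ OneStep x y with hP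
  have Psymm : ∀ {a b}, ReflTransGen P a b → ReflTransGen P b a := by
    intro a b h
    induction h with
    | refl => exact ReflTransGen.refl
    | tail _ hst ih => exact ReflTransGen.head ⟨hst.2.1, hst.1, hst.2.2.symm⟩ ih
  have notTT_far : ∀ {z}, B.farB z → z ∈ (↑B.TT : Set (ℤ × ℤ))ᶜ := fun hz h => hz.1 (Finset.mem_coe.1 h)
  have notTT_sq : ∀ {z}, z ∈ B.SQB → z ∈ (↑B.TT : Set (ℤ × ℤ))ᶜ := fun hz h =>
    Finset.disjoint_left.1 B.disj (Finset.mem_coe.1 h) hz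
  -- every block outside `TT` chains outside `TT` to a far block
  have toFar : ∀ z, z ∉ B.TT → ∃ f, B.farB f ∧ ReflTransGen P z f := by
    intro z hz
    by_cases hzS : z ∈ B.SQB
    · obtain ⟨q', f, hqq', hq'f, hf⟩ := blockData_SQ_far (𝔖 := 𝔖) (hR := hR) z hzS
      have h1 : ReflTransGen P z q' :=
        reflTransGen_of_imp' hqq' fun x y ⟨hx, hy, hxy⟩ => ⟨notTT_sq hx, notTT_sq hy, hxy⟩
      have hq'S : q' ∈ B.SQB := by
        clear h1
        induction hqq' with
        | refl => exact hzS
        | tail _ h _ => exact h.2.1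
      exact ⟨f, hf, h1.tail ⟨notTT_sq hq'S, notTT_far hf, hq'f⟩⟩
    · exact ⟨z, ⟨hz, hzS⟩, ReflTransGen.refl⟩
  intro u u' hu hu'
  have huT : bOf t δ u ∉ B.TT := fun h => hu (B.mem_Wv_of_mem_TT h)
  have hu'T : bOf t δ u' ∉ B.TT := fun h => hu' (B.mem_Wv_of_mem_TT h)
  obtain ⟨f, hf, hzf⟩ := toFar _ huT
  obtain ⟨f', hf', hzf'⟩ := toFar _ hu'T
  have hff' : ReflTransGen P f f' :=
    reflTransGen_of_imp' (blockData_far_conn (𝔖 := 𝔖) (hR := hR) f f' hf hf')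
      fun x y ⟨hx, hy, hxy⟩ => ⟨notTT_far hx, notTT_far hy, hxy⟩
  have hchain : ReflTransGen P (bOf t δ u) (bOf t δ u') := (hzf.trans hff').trans (Psymm hzf')
  have h := sites_chain_of_block_chain (S := (↑B.TT : Set (ℤ × ℤ))ᶜ) ht hδ (by linarith) hchain rfl rfl huT
  refine reflTransGen_of_imp' h fun x y ⟨hx, hy, hxy⟩ => ⟨fun h' => hx (B.mem_TT_of_mem_Wv h'), fun h' => hy (B.mem_TT_of_mem_Wv h'), hxy⟩
where
  /-- transport of reflexive-transitive chains along an implication -/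
  reflTransGen_of_imp' {α : Type} {r s : α → α → Prop} {a b : α} (h : ReflTransGen r a b)
      (hrs : ∀ x y, r x y → s x y) : ReflTransGen s a b := by
    induction h with
    | refl => exact ReflTransGen.refl
    | tail _ hxy ih => exact ih.tail (hrs _ _ hxy)

include hR4 hδt in
/-- **The owners of the hub contacts of a strip are few, independently of the mesh.**
[cite: SchrammSmirnov2011, §4, proof of Prop. 4.1 ("on ¬S the number of bays is bounded by a constant depending only on s′, β, β′ and Q₀")] -/
theorem exists_owners_stripZones {X : Finset (Sym2 (Site 2))} {ω : BondConfig (Site 2)}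
    (hT : Seeded.IsTerminal (𝔖.stripZones k hR t δ ht hδ).seeds X ω) {d₀ : Site 2 × Fin 4}
    (h₀ : IsBd ((𝔖.stripZones k hR t δ ht hδ).tileData hT (stripZones_nice hR4 hδt)).U d₀) :
    ∃ Rset : Finset (Site 2),
      (∀ i, ((𝔖.stripZones k hR t δ ht hδ).tileData hT (stripZones_nice hR4 hδt)).hubContact d₀ i →
        ∀ v ∈ ((𝔖.stripZones k hR t δ ht hδ).tileData hT (stripZones_nice hR4 hδt)).att
          (((𝔖.stripZones k hR t δ ht hδ).tileData hT (stripZones_nice hR4 hδt)).outCell d₀ i),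
          ∃ r ∈ Rset, ((𝔖.stripZones k hR t δ ht hδ).tileData hT (stripZones_nice hR4 hδt)).HubConn v r) ∧
      Rset.card ≤ max 1 (2 * (((𝔖.stripZones k hR t δ ht hδ).tileData hT (stripZones_nice hR4 hδt)).landings).card +
        (2 * (((𝔖.stripZones k hR t δ ht hδ).tileData hT (stripZones_nice hR4 hδt)).runEnds
              (↑(𝔖.stripZones k hR t δ ht hδ).SQ : Set (Site 2)) (stripZones_Wv_finite)).card +
          (((𝔖.stripZones k hR t δ ht hδ).tileData hT (stripZones_nice hR4 hδt)).farSqFaces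
              (↑(𝔖.stripZones k hR t δ ht hδ).SQ : Set (Site 2)) (stripZones_Wv_finite)).card +
          (TileData.sqCorners (↑(𝔖.stripZones k hR t δ ht hδ).SQ : Set (Site 2))
              (𝔖.stripZones k hR t δ ht hδ).SQ.finite_toSet).card)) := by
  set 𝒵 := 𝔖.stripZones k hR t δ ht hδ with h𝒵
  have hN : 𝒵.Nice := stripZones_nice hR4 hδt
  have pkg := 𝒵.tileData_package_sq hT hN (stripZones_N_edge hδt) (stripZones_SQ_esc hR4 hδt)
    (stripZones_far_conn hδt)
  exact TileData.exists_owners_sq_cutoff (SQ := (↑𝒵.SQ : Set (Site 2)))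
    (hSQW := fun q hq => 𝒵.not_mem_Wv_of_mem_SQ hT hN q hq) (hSQO := fun q hq => 𝒵.not_mem_O_of_mem_SQ hT hN q hq)
    (hWconn := stripZones_Wconn hδt) (hWfin := stripZones_Wv_finite) (hSQfin := 𝒵.SQ.finite_toSet)
    (hT := pkg.1) (hfarO := 𝒵.tileData_farO_sq hT hN) (hX := 𝒵.tileData_examined_of_leaving_sq hT hN) (h₀ := h₀)
    (hdisj := 𝒵.tileData_hdisj hT hN) (hfar := pkg.2)

end FineBlocks.StripData

end Literature.Probability.Percolation

end
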